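import Mathlib
import HarnessLib

/-!
# Route `F4SubCurvatureDoor`, crux ⟨stmt-QuantumFields-23125⟩ `RationalToGeneral`: LINE g18-A v5 «top-channel cone cut»
# (planner `ym-idea-3` g18, tree skeleton `Cruxes/RationalToGeneral/Lines/sextic_channel.lean` commit 9dfcf5fb94f6) —
# the content of the registered stub `stub_coneFatouEndgame`, SPELLED OUT and DEF-FREE

**Theorem** (`coneFatouEndgame`, the cone–Fatou endgame).  Let `φ ≥ 0` be measurable, continuous at `0` from the right, with
`φ 0 > 0`; let `(ρ⁺_a, ρ⁻_a)_{a ∈ A}` be finitely many pairs of locally finite measures on `ℝ` carried by `[0, ∞)` whose increments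
`v_S(a) = ρ⁺_a(S) − ρ⁻_a(S)` on bounded measurable sets lie in the cone `{v : ∀ q⃗, Σ_a v_a N_a(q⃗) ≥ 0}` (`N_a : ℝ³ → ℝ`), the cone
being POINTED (`Σ_a v_a N_a(q⃗) = 0 ∀ q⃗ ⇒ v = 0`), and assume the budget `∫ φ(M r) dρ⁺_a(M) − ∫ φ(M r) dρ⁻_a(M) → 0` as `r → 0⁺`
for every `a`.  Then `ρ⁺_a = ρ⁻_a` for every `a`.

Proof (no Farkas lemma / strictly positive functional is needed — the cone is tested one `q⃗` at a time):
* for a coefficient vector `c` (here `c_a = N_a(q⃗)`) form the two honest MEASURES `P_c = Σ_a (c_a⁺ ρ⁺_a + c_a⁻ ρ⁻_a)` and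
  `Q_c = Σ_a (c_a⁻ ρ⁺_a + c_a⁺ ρ⁻_a)`; on sets of finite mass `P_c(S) − Q_c(S) = Σ_a c_a v_S(a)` (`toReal_pair_sub`), so the cone
  hypothesis says `Q_c ≤ P_c` on bounded sets, hence as measures (`measure_le_of_forall_bounded`, exhaustion by `[−n, n]`);
* the budget gives `∫ φ(Mr) dP_c − ∫ φ(Mr) dQ_c = Σ_a c_a · (budget_a) → 0` (`integral_pair`);
* `Q_c ≤ P_c` on the complement of `[0, n]` and `φ ≥ 0` give `∫_{[0,n]} φ(Mr) dP_c − ∫_{[0,n]} φ(Mr) dQ_c ≤ ∫ φ(Mr) dP_c − ∫ φ(Mr) dQ_c`,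
  while dominated convergence on the FINITE measures `P_c|[0,n]`, `Q_c|[0,n]` (`φ(Mr) → φ(0)`, bound `φ(0) + 1` once `n r < δ`)
  sends the left side to `φ(0) · (P_c[0,n] − Q_c[0,n]) ≥ 0` (`tendsto_setIntegral_Icc`); so `P_c[0,n] = Q_c[0,n]`, and with
  `Q_c ≤ P_c` the two measures agree on every measurable subset of `[0, n]`;
* hence `Σ_a v_S(a) N_a(q⃗) = 0` for every `q⃗` and every measurable `S ⊆ [0, n]`; pointedness gives `v_S = 0`; the measures vanish on
  `(−∞, 0)`, so `ρ⁺_a = ρ⁻_a` (`Measure.ext_iff_of_iUnion_eq_univ` with the cover `(−∞,0) ∪ [0,n]`).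

Mathlib only; THEOREMS ONLY (no definitions); no named facts; no `sorry`; default heartbeats.  The statement of `coneFatouEndgame` is
the body of the skeleton's `ConeFatouEndgame` with its one abbreviation `E3 = EuclideanSpace ℝ (Fin 3)` spelled out (the by-name port
is a separate file).  HONEST FRAMING: classical measure theory serving support stub `ConeFatouEndgame` of an OPEN line; nothing
about the wall T1″ (`AnalyticFiniteType`), `ChannelShellForm`, C3, crux 23125 / 23035, rung R2d or the summit is proved here; the
Yang–Mills mass gap is NOT proved.  Fleet seat `ym-spine-19353-p1` g24 (free capacity; announced on the owner's bus 2026-08-29T03:24Z),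
`--supports stmt-QuantumFields-23125`. [folklore]
-/

set_option autoImplicit false

noncomputable section

open scoped Topology BigOperators ENNReal
open Filter Set MeasureTheory

namespace Summit.QuantumFields.YangMills.Theorems.F4SubCurvatureDoorConeFatouEndgame

/-! ## §1 Arithmetic of a finite sum of weighted pairs of measures -/

section Pair

variable {A : Type} [Fintype A]

/-- Evaluation of `Σ_a (x_a • ρ⁺_a + y_a • ρ⁻_a)` on a set. [folklore] -/
theorem pair_apply (x y : A → ℝ≥0∞) (ρp ρm : A → Measure ℝ) (S : Set ℝ) :
    (∑ a, (x a • ρp a + y a • ρm a)) S = ∑ a, (x a * ρp a S + y a * ρm a S) := by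
  simp only [Measure.coe_finsetSum, Finset.sum_apply, Measure.coe_add, Pi.add_apply, Measure.coe_smul,
    Pi.smul_apply, smul_eq_mul]

/-- The weighted pair measure (real weights through `ENNReal.ofReal`) is finite on sets where all `ρ⁺_a, ρ⁻_a` are. [folklore] -/
theorem pair_apply_ne_top (x y : A → ℝ) (ρp ρm : A → Measure ℝ) (S : Set ℝ)
    (hp : ∀ a, ρp a S ≠ ∞) (hm : ∀ a, ρm a S ≠ ∞) :
    (∑ a, (ENNReal.ofReal (x a) • ρp a + ENNReal.ofReal (y a) • ρm a)) S ≠ ∞ := by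
  rw [pair_apply]
  refine (ENNReal.sum_lt_top.2 fun a _ => ?_).ne
  exact ENNReal.add_lt_top.2
    ⟨ENNReal.mul_lt_top ENNReal.ofReal_lt_top (hp a).lt_top,
      ENNReal.mul_lt_top ENNReal.ofReal_lt_top (hm a).lt_top⟩

/-- **`P_c(S) − Q_c(S) = Σ_a c_a (ρ⁺_a S − ρ⁻_a S)`** on sets of finite mass, for `P_c = Σ_a (c_a⁺ ρ⁺_a + c_a⁻ ρ⁻_a)`,
`Q_c = Σ_a (c_a⁻ ρ⁺_a + c_a⁺ ρ⁻_a)` (`c⁺ = ENNReal.ofReal c`, `c⁻ = ENNReal.ofReal (−c)`). [folklore] -/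
theorem toReal_pair_sub (c : A → ℝ) (ρp ρm : A → Measure ℝ) (S : Set ℝ)
    (hp : ∀ a, ρp a S ≠ ∞) (hm : ∀ a, ρm a S ≠ ∞) :
    ((∑ a, (ENNReal.ofReal (c a) • ρp a + ENNReal.ofReal (-(c a)) • ρm a)) S).toReal
      - ((∑ a, (ENNReal.ofReal (-(c a)) • ρp a + ENNReal.ofReal (c a) • ρm a)) S).toReal
      = ∑ a, c a * ((ρp a S).toReal - (ρm a S).toReal) := by
  have hfin : ∀ (u v : ℝ) (a : A), ENNReal.ofReal u * ρp a S + ENNReal.ofReal v * ρm a S ≠ ∞ := fun u v a =>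
    ENNReal.add_ne_top.2 ⟨ENNReal.mul_ne_top ENNReal.ofReal_ne_top (hp a), ENNReal.mul_ne_top ENNReal.ofReal_ne_top (hm a)⟩
  rw [pair_apply, pair_apply, ENNReal.toReal_sum (fun a _ => hfin _ _ a), ENNReal.toReal_sum (fun a _ => hfin _ _ a),
    ← Finset.sum_sub_distrib]
  refine Finset.sum_congr rfl fun a _ => ?_
  rw [ENNReal.toReal_add (ENNReal.mul_ne_top ENNReal.ofReal_ne_top (hp a)) (ENNReal.mul_ne_top ENNReal.ofReal_ne_top (hm a)),
    ENNReal.toReal_add (ENNReal.mul_ne_top ENNReal.ofReal_ne_top (hp a)) (ENNReal.mul_ne_top ENNReal.ofReal_ne_top (hm a)),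
    ENNReal.toReal_mul, ENNReal.toReal_mul, ENNReal.toReal_mul, ENNReal.toReal_mul, ENNReal.toReal_ofReal',
    ENNReal.toReal_ofReal']
  have h := max_zero_sub_max_neg_zero_eq_self (c a)
  calc max (c a) 0 * (ρp a S).toReal + max (-c a) 0 * (ρm a S).toReal
        - (max (-c a) 0 * (ρp a S).toReal + max (c a) 0 * (ρm a S).toReal)
        = (max (c a) 0 - max (-c a) 0) * ((ρp a S).toReal - (ρm a S).toReal) := by ring
    _ = c a * ((ρp a S).toReal - (ρm a S).toReal) := by rw [h]

/-- **`∫ f d(Σ_a (x_a ρ⁺_a + y_a ρ⁻_a)) = Σ_a (x_a ∫ f dρ⁺_a + y_a ∫ f dρ⁻_a)`** for finite weights and `f` integrable for every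
`ρ⁺_a, ρ⁻_a`. [folklore] -/
theorem integral_pair (x y : A → ℝ≥0∞) (hx : ∀ a, x a ≠ ∞) (hy : ∀ a, y a ≠ ∞) (ρp ρm : A → Measure ℝ) (f : ℝ → ℝ)
    (hfp : ∀ a, Integrable f (ρp a)) (hfm : ∀ a, Integrable f (ρm a)) :
    ∫ M, f M ∂(∑ a, (x a • ρp a + y a • ρm a))
      = ∑ a, ((x a).toReal * ∫ M, f M ∂(ρp a) + (y a).toReal * ∫ M, f M ∂(ρm a)) := by
  rw [integral_finsetSum_measure (fun a _ => ((hfp a).smul_measure (hx a)).add_measure ((hfm a).smul_measure (hy a)))]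
  refine Finset.sum_congr rfl fun a _ => ?_
  rw [integral_add_measure ((hfp a).smul_measure (hx a)) ((hfm a).smul_measure (hy a)), integral_smul_measure,
    integral_smul_measure, smul_eq_mul, smul_eq_mul]

/-- Integrability for the weighted pair measure. [folklore] -/
theorem integrable_pair (x y : A → ℝ≥0∞) (hx : ∀ a, x a ≠ ∞) (hy : ∀ a, y a ≠ ∞) (ρp ρm : A → Measure ℝ) (f : ℝ → ℝ)
    (hfp : ∀ a, Integrable f (ρp a)) (hfm : ∀ a, Integrable f (ρm a)) :
    Integrable f (∑ a, (x a • ρp a + y a • ρm a)) :=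
  integrable_finsetSum_measure.2 fun a _ => ((hfp a).smul_measure (hx a)).add_measure ((hfm a).smul_measure (hy a))

end Pair

/-! ## §2 Measure-theoretic lemmas on `ℝ` -/

/-- A measure inequality tested on bounded measurable sets holds everywhere (exhaustion by `[−n, n]`, continuity from below).
[folklore] -/
theorem measure_le_of_forall_bounded {μ ν : Measure ℝ}
    (h : ∀ S : Set ℝ, MeasurableSet S → Bornology.IsBounded S → ν S ≤ μ S) : ν ≤ μ := by
  rw [Measure.le_iff]
  intro s hs
  have hmono : Monotone fun n : ℕ => s ∩ Icc (-(n : ℝ)) n := by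
    intro m n hmn
    refine inter_subset_inter_right _ (Icc_subset_Icc ?_ ?_)
    · exact neg_le_neg (Nat.cast_le.2 hmn)
    · exact Nat.cast_le.2 hmn
  have hU : (⋃ n : ℕ, s ∩ Icc (-(n : ℝ)) n) = s := by
    ext x
    simp only [mem_iUnion, mem_inter_iff, mem_Icc]
    constructor
    · rintro ⟨n, hx, -⟩
      exact hx
    · intro hx
      obtain ⟨n, hn⟩ := exists_nat_ge |x|
      exact ⟨n, hx, (abs_le.1 hn).1, (abs_le.1 hn).2⟩
  have h1 := tendsto_measure_iUnion_atTop (μ := ν) hmono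
  have h2 := tendsto_measure_iUnion_atTop (μ := μ) hmono
  rw [hU] at h1 h2
  exact le_of_tendsto_of_tendsto' h1 h2 fun n =>
    h _ (hs.inter measurableSet_Icc) ((Metric.isBounded_Icc _ _).subset inter_subset_right)

/-- In `ℝ≥0∞`: `a ≤ b`, `c ≤ d`, `b + d = a + c < ∞` force `a = b`. [folklore] -/
theorem eq_of_le_of_add_eq {a b c d : ℝ≥0∞} (hab : a ≤ b) (hcd : c ≤ d) (h : b + d = a + c) (hfin : b + d ≠ ∞) :
    a = b := by
  have hb : b ≠ ∞ := (ENNReal.add_ne_top.1 hfin).1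
  have hd : d ≠ ∞ := (ENNReal.add_ne_top.1 hfin).2
  have ha : a ≠ ∞ := ne_top_of_le_ne_top hb hab
  have hc : c ≠ ∞ := ne_top_of_le_ne_top hd hcd
  have h' := congrArg ENNReal.toReal h
  rw [ENNReal.toReal_add hb hd, ENNReal.toReal_add ha hc] at h'
  have hab' := (ENNReal.toReal_le_toReal ha hb).2 hab
  have hcd' := (ENNReal.toReal_le_toReal hc hd).2 hcd
  exact (ENNReal.toReal_eq_toReal_iff' ha hb).1 (by linarith)

/-- If `μ` vanishes on `(−∞, 0)` then `μ (T ∩ ((−∞,0) ∪ [0,n])) = μ (T ∩ [0,n])`. [folklore] -/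
theorem measure_inter_cover_eq (μ : Measure ℝ) (h0 : μ (Iio 0) = 0) (T : Set ℝ) (n : ℕ) :
    μ (T ∩ (Iio 0 ∪ Icc 0 (n : ℝ))) = μ (T ∩ Icc 0 (n : ℝ)) := by
  rw [inter_union_distrib_left]
  have hnull : μ (T ∩ Iio 0) = 0 := measure_mono_null inter_subset_right h0
  refine le_antisymm ((measure_union_le _ _).trans ?_) (measure_mono subset_union_right)
  rw [hnull, zero_add]

/-- The cover `(−∞,0) ∪ [0,n]`, `n ∈ ℕ`, exhausts `ℝ`. [folklore] -/
theorem iUnion_cover_eq_univ : (⋃ n : ℕ, (Iio (0 : ℝ) ∪ Icc 0 (n : ℝ))) = univ := by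
  ext x
  simp only [mem_iUnion, mem_union, mem_Iio, mem_Icc, mem_univ, iff_true]
  by_cases hx : x < 0
  · exact ⟨0, Or.inl hx⟩
  · exact ⟨⌈x⌉₊, Or.inr ⟨not_lt.1 hx, Nat.le_ceil x⟩⟩

/-- **Dominated convergence on `[0, n]`**: for `φ ≥ 0` measurable and continuous at `0` from the right and a measure `μ` with
`μ[0,n] < ∞`, `∫_{[0,n]} φ(M r) dμ(M) → φ(0) · μ[0,n]` as `r → 0⁺`. [folklore] -/
theorem tendsto_setIntegral_Icc (φ : ℝ → ℝ) (hφm : Measurable φ) (hφ0 : ∀ u, 0 ≤ φ u)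
    (hφc : ContinuousWithinAt φ (Set.Ici 0) 0) (μ : Measure ℝ) (n : ℕ) (hμ : μ (Icc 0 (n : ℝ)) ≠ ∞) :
    Tendsto (fun r : ℝ => ∫ M in Icc (0 : ℝ) n, φ (M * r) ∂μ) (𝓝[>] 0)
      (𝓝 (φ 0 * (μ (Icc (0 : ℝ) n)).toReal)) := by
  haveI : IsFiniteMeasure (μ.restrict (Icc (0 : ℝ) n)) := isFiniteMeasure_restrict.2 hμ
  obtain ⟨δ, hδ, hδφ⟩ : ∃ δ > 0, ∀ u : ℝ, 0 ≤ u → u < δ → φ u ≤ φ 0 + 1 := by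
    obtain ⟨δ, hδ, h⟩ := Metric.continuousWithinAt_iff.1 hφc 1 one_pos
    refine ⟨δ, hδ, fun u hu hud => ?_⟩
    have h' : dist (φ u) (φ 0) < 1 := h hu (by rwa [dist_zero_right, Real.norm_eq_abs, abs_of_nonneg hu])
    rw [Real.dist_eq] at h'
    linarith [le_abs_self (φ u - φ 0)]
  have hlim : Tendsto (fun r : ℝ => ∫ M in Icc (0 : ℝ) n, φ (M * r) ∂μ) (𝓝[>] 0)
      (𝓝 (∫ _ in Icc (0 : ℝ) n, φ 0 ∂μ)) := by
    refine tendsto_integral_filter_of_dominated_convergence (fun _ => φ 0 + 1) ?_ ?_ (integrable_const _) ?_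
    · exact Eventually.of_forall fun r => (hφm.comp (measurable_id.mul_const r)).aestronglyMeasurable
    · have hpos : (0 : ℝ) < δ / ((n : ℝ) + 1) := by positivity
      filter_upwards [Ioo_mem_nhdsGT hpos] with r hr
      refine (ae_restrict_mem measurableSet_Icc).mono fun M hM => ?_
      rw [Real.norm_eq_abs, abs_of_nonneg (hφ0 _)]
      refine hδφ _ (mul_nonneg hM.1 hr.1.le) ?_
      have hn1 : (0 : ℝ) < (n : ℝ) + 1 := by positivity
      calc M * r ≤ (n : ℝ) * r := mul_le_mul_of_nonneg_right hM.2 hr.1.le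
        _ ≤ ((n : ℝ) + 1) * r := by nlinarith [hr.1]
        _ < ((n : ℝ) + 1) * (δ / ((n : ℝ) + 1)) := by gcongr; exact hr.2
        _ = δ := by field_simp
    · refine (ae_restrict_mem measurableSet_Icc).mono fun M hM => ?_
      have h1 : Tendsto (fun r : ℝ => M * r) (𝓝[>] 0) (𝓝[Ici 0] 0) := by
        apply tendsto_nhdsWithin_of_tendsto_nhds_of_eventually_within
        · have h2 : Tendsto (fun r : ℝ => M * r) (𝓝 0) (𝓝 (M * 0)) := tendsto_const_nhds.mul tendsto_id
          rw [mul_zero] at h2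
          exact h2.mono_left nhdsWithin_le_nhds
        · filter_upwards [self_mem_nhdsWithin] with r (hr : 0 < r)
          exact mul_nonneg hM.1 hr.le
      exact hφc.tendsto.comp h1
  rw [setIntegral_const, measureReal_def, smul_eq_mul, mul_comm] at hlim
  exact hlim

/-! ## §3 The endgame -/

/-- **The cone–Fatou endgame** — the body of the registered stub `ConeFatouEndgame` of LINE g18-A v5 (crux 23125), with
`E3 = EuclideanSpace ℝ (Fin 3)` spelled out.  See the module docstring for the proof. [folklore] -/
theorem coneFatouEndgame :
    ∀ (φ : ℝ → ℝ), Measurable φ → (∀ u, 0 ≤ φ u) → ContinuousWithinAt φ (Set.Ici 0) 0 → 0 < φ 0 →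
    ∀ (A : Type) [Fintype A] (N : A → EuclideanSpace ℝ (Fin 3) → ℝ) (ρp ρm : A → Measure ℝ),
      (∀ a, IsLocallyFiniteMeasure (ρp a) ∧ IsLocallyFiniteMeasure (ρm a)) →
      (∀ a, (ρp a) (Set.Iio 0) = 0 ∧ (ρm a) (Set.Iio 0) = 0) →
      (∀ v : A → ℝ, (∀ q : EuclideanSpace ℝ (Fin 3), ∑ a, v a * N a q = 0) → v = 0) →
      (∀ S : Set ℝ, MeasurableSet S → Bornology.IsBounded S →
          ∀ q : EuclideanSpace ℝ (Fin 3), 0 ≤ ∑ a, (((ρp a) S).toReal - ((ρm a) S).toReal) * N a q) →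
      (∀ a (r : ℝ), 0 < r → Integrable (fun M => φ (M * r)) (ρp a) ∧ Integrable (fun M => φ (M * r)) (ρm a)) →
      (∀ a, Tendsto (fun r : ℝ => (∫ M, φ (M * r) ∂(ρp a)) - ∫ M, φ (M * r) ∂(ρm a)) (𝓝[>] 0) (𝓝 0)) →
      ∀ a, ρp a = ρm a := by
  intro φ hφm hφ0 hφc hφpos A _ N ρp ρm hlf hsupp hpt hcone hint hbud
  -- finiteness on bounded sets
  have hfinp : ∀ a (S : Set ℝ), Bornology.IsBounded S → ρp a S ≠ ∞ := fun a S hS => by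
    haveI := (hlf a).1; exact hS.measure_lt_top.ne
  have hfinm : ∀ a (S : Set ℝ), Bornology.IsBounded S → ρm a S ≠ ∞ := fun a S hS => by
    haveI := (hlf a).2; exact hS.measure_lt_top.ne
  -- STEP A: the measures agree on measurable subsets of `[0, n]`
  have stepA : ∀ (n : ℕ) (S : Set ℝ), MeasurableSet S → S ⊆ Icc (0 : ℝ) n → ∀ a, ρp a S = ρm a S := by
    intro n S hS hSsub
    have hSb : Bornology.IsBounded S := (Metric.isBounded_Icc _ _).subset hSsub
    -- for every q⃗, `Σ_a v_S(a) N_a(q⃗) = 0`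
    have hzero : ∀ q : EuclideanSpace ℝ (Fin 3), ∑ a, (((ρp a) S).toReal - ((ρm a) S).toReal) * N a q = 0 := by
      intro q
      -- the positive pair attached to `c = N · q`
      set c : A → ℝ := fun a => N a q with hc
      set P : Measure ℝ := ∑ a, (ENNReal.ofReal (c a) • ρp a + ENNReal.ofReal (-(c a)) • ρm a) with hP
      set Q : Measure ℝ := ∑ a, (ENNReal.ofReal (-(c a)) • ρp a + ENNReal.ofReal (c a) • ρm a) with hQ
      have hPfin : ∀ T : Set ℝ, Bornology.IsBounded T → P T ≠ ∞ := fun T hT =>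
        pair_apply_ne_top _ _ ρp ρm T (fun a => hfinp a T hT) (fun a => hfinm a T hT)
      have hQfin : ∀ T : Set ℝ, Bornology.IsBounded T → Q T ≠ ∞ := fun T hT =>
        pair_apply_ne_top _ _ ρp ρm T (fun a => hfinp a T hT) (fun a => hfinm a T hT)
      have hdiff : ∀ T : Set ℝ, Bornology.IsBounded T →
          (P T).toReal - (Q T).toReal = ∑ a, (((ρp a) T).toReal - ((ρm a) T).toReal) * N a q := by
        intro T hT
        rw [hP, hQ, toReal_pair_sub c ρp ρm T (fun a => hfinp a T hT) (fun a => hfinm a T hT)]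
        exact Finset.sum_congr rfl fun a _ => mul_comm _ _
      -- (i) `Q ≤ P`
      have hQP : Q ≤ P := by
        refine measure_le_of_forall_bounded fun T hT hTb => ?_
        have h1 : (Q T).toReal ≤ (P T).toReal := by
          have := hcone T hT hTb q
          rw [← hdiff T hTb] at this
          linarith
        exact (ENNReal.toReal_le_toReal (hQfin T hTb) (hPfin T hTb)).1 h1
      -- (ii) `P [0,n] = Q [0,n]` — the analytic heart
      have hIccb : Bornology.IsBounded (Icc (0 : ℝ) n) := Metric.isBounded_Icc _ _
      have hheart : P (Icc (0 : ℝ) n) = Q (Icc (0 : ℝ) n) := by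
        -- the full difference tends to `0`
        have hD : Tendsto (fun r : ℝ => (∫ M, φ (M * r) ∂P) - ∫ M, φ (M * r) ∂Q) (𝓝[>] 0) (𝓝 0) := by
          have hsum : Tendsto (fun r : ℝ => ∑ a, c a * ((∫ M, φ (M * r) ∂(ρp a)) - ∫ M, φ (M * r) ∂(ρm a)))
              (𝓝[>] 0) (𝓝 (∑ a, c a * 0)) :=
            tendsto_finsetSum _ fun a _ => (hbud a).const_mul (c a)
          simp only [mul_zero, Finset.sum_const_zero] at hsum
          refine hsum.congr' ?_
          filter_upwards [self_mem_nhdsWithin] with r (hr : 0 < r)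
          rw [hP, hQ,
            integral_pair _ _ (fun a => ENNReal.ofReal_ne_top) (fun a => ENNReal.ofReal_ne_top) ρp ρm _
              (fun a => (hint a r hr).1) (fun a => (hint a r hr).2),
            integral_pair _ _ (fun a => ENNReal.ofReal_ne_top) (fun a => ENNReal.ofReal_ne_top) ρp ρm _
              (fun a => (hint a r hr).1) (fun a => (hint a r hr).2),
            ← Finset.sum_sub_distrib]
          refine Finset.sum_congr rfl fun a _ => ?_
          rw [ENNReal.toReal_ofReal', ENNReal.toReal_ofReal']
          have h := max_zero_sub_max_neg_zero_eq_self (c a)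
          calc c a * ((∫ M, φ (M * r) ∂(ρp a)) - ∫ M, φ (M * r) ∂(ρm a))
              = (max (c a) 0 - max (-c a) 0) * ((∫ M, φ (M * r) ∂(ρp a)) - ∫ M, φ (M * r) ∂(ρm a)) := by rw [h]
            _ = max (c a) 0 * (∫ M, φ (M * r) ∂(ρp a)) + max (-c a) 0 * (∫ M, φ (M * r) ∂(ρm a))
                  - (max (-c a) 0 * (∫ M, φ (M * r) ∂(ρp a)) + max (c a) 0 * (∫ M, φ (M * r) ∂(ρm a))) := by ring
        -- the restricted difference tends to `φ 0 · (P[0,n] − Q[0,n])`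
        have hDn : Tendsto (fun r : ℝ => (∫ M in Icc (0 : ℝ) n, φ (M * r) ∂P) - ∫ M in Icc (0 : ℝ) n, φ (M * r) ∂Q)
            (𝓝[>] 0) (𝓝 (φ 0 * (P (Icc (0 : ℝ) n)).toReal - φ 0 * (Q (Icc (0 : ℝ) n)).toReal)) :=
          (tendsto_setIntegral_Icc φ hφm hφ0 hφc P n (hPfin _ hIccb)).sub
            (tendsto_setIntegral_Icc φ hφm hφ0 hφc Q n (hQfin _ hIccb))
        -- the restricted difference is below the full one (tail comparison through `Q ≤ P`, `φ ≥ 0`)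
        have hle : ∀ᶠ r in 𝓝[>] (0 : ℝ),
            (∫ M in Icc (0 : ℝ) n, φ (M * r) ∂P) - ∫ M in Icc (0 : ℝ) n, φ (M * r) ∂Q
              ≤ (∫ M, φ (M * r) ∂P) - ∫ M, φ (M * r) ∂Q := by
          filter_upwards [self_mem_nhdsWithin] with r (hr : 0 < r)
          have hIP : Integrable (fun M => φ (M * r)) P := by
            rw [hP]
            exact integrable_pair _ _ (fun a => ENNReal.ofReal_ne_top) (fun a => ENNReal.ofReal_ne_top) ρp ρm _
              (fun a => (hint a r hr).1) (fun a => (hint a r hr).2)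
          have hIQ : Integrable (fun M => φ (M * r)) Q := by
            rw [hQ]
            exact integrable_pair _ _ (fun a => ENNReal.ofReal_ne_top) (fun a => ENNReal.ofReal_ne_top) ρp ρm _
              (fun a => (hint a r hr).1) (fun a => (hint a r hr).2)
          have hsplitP := integral_add_compl (μ := P) (s := Icc (0 : ℝ) n) measurableSet_Icc hIP
          have hsplitQ := integral_add_compl (μ := Q) (s := Icc (0 : ℝ) n) measurableSet_Icc hIQ
          have htail : (∫ M in (Icc (0 : ℝ) n)ᶜ, φ (M * r) ∂Q) ≤ ∫ M in (Icc (0 : ℝ) n)ᶜ, φ (M * r) ∂P :=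
            integral_mono_measure (Measure.restrict_mono subset_rfl hQP)
              (Eventually.of_forall fun M => hφ0 _) hIP.integrableOn
          linarith
        have hcmp := le_of_tendsto_of_tendsto hDn hD hle
        -- `Q[0,n] ≤ P[0,n]` and `φ 0 > 0` force equality
        have hQP' : (Q (Icc (0 : ℝ) n)).toReal ≤ (P (Icc (0 : ℝ) n)).toReal :=
          (ENNReal.toReal_le_toReal (hQfin _ hIccb) (hPfin _ hIccb)).2 (hQP _)
        have heq : (P (Icc (0 : ℝ) n)).toReal = (Q (Icc (0 : ℝ) n)).toReal := by
          nlinarith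
        exact (ENNReal.toReal_eq_toReal_iff' (hPfin _ hIccb) (hQfin _ hIccb)).1 heq
      -- (iii) sandwich: `P S = Q S`
      have hPS : Q S = P S := by
        have hunion : S ∪ (Icc (0 : ℝ) n \ S) = Icc (0 : ℝ) n := union_sdiff_cancel hSsub
        have hPsum : P (Icc (0 : ℝ) n) = P S + P (Icc (0 : ℝ) n \ S) := by
          rw [← measure_union disjoint_sdiff_right (measurableSet_Icc.diff hS), hunion]
        have hQsum : Q (Icc (0 : ℝ) n) = Q S + Q (Icc (0 : ℝ) n \ S) := by
          rw [← measure_union disjoint_sdiff_right (measurableSet_Icc.diff hS), hunion]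
        refine eq_of_le_of_add_eq (hQP S) (hQP (Icc (0 : ℝ) n \ S)) ?_ ?_
        · rw [← hPsum, ← hQsum, hheart]
        · rw [← hPsum]; exact hPfin _ hIccb
      have h := hdiff S hSb
      rw [hPS, sub_self] at h
      exact h.symm
    -- pointedness
    have hv := hpt (fun a => ((ρp a) S).toReal - ((ρm a) S).toReal) hzero
    intro a
    have ha : ((ρp a) S).toReal - ((ρm a) S).toReal = 0 := congrFun hv a
    exact (ENNReal.toReal_eq_toReal_iff' (hfinp a S hSb) (hfinm a S hSb)).1 (by linarith)
  -- STEP B: extension to all measurable sets through the cover `(−∞,0) ∪ [0,n]`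
  intro a
  refine (Measure.ext_iff_of_iUnion_eq_univ iUnion_cover_eq_univ).2 fun n => ?_
  refine Measure.ext fun T hT => ?_
  rw [Measure.restrict_apply hT, Measure.restrict_apply hT, measure_inter_cover_eq _ (hsupp a).1,
    measure_inter_cover_eq _ (hsupp a).2]
  exact stepA n _ (hT.inter measurableSet_Icc) inter_subset_right a

end Summit.QuantumFields.YangMills.Theorems.F4SubCurvatureDoorConeFatouEndgame

end
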